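import Summits.Parity.GeneralizedHardyLittlewood.Theorems.LiouvilleShiftedTablesEngineToPairsMAvgOfTAvgPart1
import Summits.Parity.GeneralizedHardyLittlewood.Theses.LiouvilleShiftedTables

/-!
# `TAvg → MAvg`: the `k²`-trick at a single height (stub S2 of line `Sketch`, crux `EngineToPairs`)

Route `LiouvilleShiftedTables` (Parity / GeneralizedHardyLittlewood), crux stmt-Parity-14659.
We prove `stub_MAvg_of_TAvg : TAvg → MAvg`: the hinge (`λ` of the shifted primes in ALL progressions
`q ≤ x^ε` at a common height) implies the route's terminal parity node `MAvg`
(`∑_{m ≤ x^ε} log m · |∑_{d ≤ x/m} μ(d) Λ(dm + h)| = o(x)`).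

Proof: `μ(d) = λ(d) ∑_{k² ∣ d} μ(k)` and `λ(d) = λ(m) λ(dm)` give
`S_m := ∑_{d ≤ x/m} μ(d) Λ(dm+h) = λ(m) ∑_k μ(k) T(k² m)` with
`T(q) := ∑_{n ≤ x + h, n ≡ h (q)} Λ(n) λ(n - h)` (single height `x + h`); the terms `k ≤ K` are
controlled by `TAvg` at `x + h` (for fixed `k` the map `m ↦ k² m` is injective), the terms `k > K`
trivially by `x log x / (k² m)`; with `K ≍ (log x)^4` and `A = 6` both parts are `O(x / log x)`.

Part 1 (`…MAvgOfTAvgPart1.lean`) proves the combinatorial inequality `sum_abs_slice_le` at fixed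
integer parameters; this file does the analytic assembly (`K = ⌊(log x)^4⌋ + 1`, `ε = ε_T / 4`) and
proves the stub `stub_MAvg_of_TAvg`.
-/

noncomputable section

namespace Summit.Parity.GeneralizedHardyLittlewood.Theorems.EngineToPairs

open Finset Real Filter Asymptotics
open scoped ArithmeticFunction.vonMangoldt ArithmeticFunction.Moebius
open Summit.Parity.GeneralizedHardyLittlewood.Theses.LiouvilleShiftedTables

/-! ### Analytic assembly -/

/-- `∑_{m ≤ ⌊y⌋} 1/m ≤ 1 + log y` for `y ≥ 1`. [folklore] -/
theorem sum_Icc_inv_le_one_add_log {y : ℝ} (hy : 1 ≤ y) :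
    ∑ m ∈ Icc 1 ⌊y⌋₊, (m : ℝ)⁻¹ ≤ 1 + Real.log y := by
  have := harmonic_floor_le_one_add_log y hy
  rw [harmonic_eq_sum_Icc] at this
  push_cast at this
  exact this

/-- `x / log x = o(x)`. [folklore] -/
theorem isLittleO_div_log_self : (fun x : ℝ => x / Real.log x) =o[atTop] fun x : ℝ => x := by
  have h1 : (fun x : ℝ => (Real.log x)⁻¹) =o[atTop] (fun _ : ℝ => (1 : ℝ)) :=
    (isLittleO_one_iff ℝ).2 (tendsto_inv_atTop_zero.comp tendsto_log_atTop)
  have h2 := (isBigO_refl (fun x : ℝ => x) atTop).mul_isLittleO h1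
  simpa [div_eq_mul_inv] using h2

/-- **The estimate at one large `x`.**  With `L = log x ≥ 1`, `x ≥ max 2 h`, `4 L^8 ≤ x^ε`,
`2ε ≤ ε_T` and the `TAvg` bound at `x + h` (height `x + h`, exponent `A = 6`, constant `C ≥ 0`):
`L ∑_{m ≤ x^ε} |S_m| ≤ (4C + 2(1 + ε)) x / L` (`K = ⌊L^4⌋ + 1`). [this line] -/
theorem log_mul_sum_abs_slice_le {h : ℕ} (hh : 1 ≤ h) {ε εT C x : ℝ} (hε : 0 < ε)
    (hεT : 2 * ε ≤ εT) (hC : 0 ≤ C)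
    (hTA : ∑ q ∈ Icc 1 ⌊(x + h) ^ εT⌋₊,
      |∑ n ∈ (Icc 1 (⌊x⌋₊ + h)).filter (fun n : ℕ => n ≡ h [MOD q]),
          Λ n * (ArithmeticFunction.liouville (n - h) : ℝ)| ≤ C * (x + h) / Real.log (x + h) ^ 6)
    (hL : 1 ≤ Real.log x) (hx2 : 2 ≤ x) (hxh : (h : ℝ) ≤ x)
    (hlog8 : 4 * Real.log x ^ 8 ≤ x ^ ε) :
    Real.log x * ∑ m ∈ Icc 1 ⌊x ^ ε⌋₊, |∑ d ∈ Icc 1 ⌊x / m⌋₊, (μ d : ℝ) * Λ (d * m + h)| ≤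
      (4 * C + 2 * (1 + ε)) * (x / Real.log x) := by
  set L := Real.log x
  set X := ⌊x⌋₊
  set M := ⌊x ^ ε⌋₊
  set Q := ⌊(x + h) ^ εT⌋₊
  have hx0 : 0 ≤ x := by linarith
  have hx1 : 1 ≤ x := by linarith
  have hL0 : 0 < L := by linarith
  have hh0 : (0 : ℝ) ≤ h := Nat.cast_nonneg h
  -- the cut `K = ⌊L^4⌋ + 1`
  obtain ⟨K, hK1, hKgt, hKle⟩ : ∃ K : ℕ, 1 ≤ K ∧ L ^ 4 < K ∧ (K : ℝ) ≤ 2 * L ^ 4 := by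
    refine ⟨⌊L ^ 4⌋₊ + 1, by omega, ?_, ?_⟩
    · push_cast
      exact Nat.lt_floor_add_one _
    · push_cast
      have h1 : (⌊L ^ 4⌋₊ : ℝ) ≤ L ^ 4 := Nat.floor_le (by positivity)
      have h2 : (1 : ℝ) ≤ L ^ 4 := one_le_pow₀ hL
      linarith
  -- `K² M ≤ Q`
  have hM : (M : ℝ) ≤ x ^ ε := Nat.floor_le (by positivity)
  have hKMQ : K ^ 2 * M ≤ Q := by
    refine Nat.le_floor ?_
    push_cast
    calc (K : ℝ) ^ 2 * M ≤ (2 * L ^ 4) ^ 2 * x ^ ε := by gcongr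
      _ = 4 * L ^ 8 * x ^ ε := by ring
      _ ≤ x ^ ε * x ^ ε := by gcongr
      _ = x ^ (2 * ε) := by rw [← Real.rpow_add (by linarith), ← two_mul]
      _ ≤ x ^ εT := Real.rpow_le_rpow_of_exponent_le hx1 hεT
      _ ≤ (x + h) ^ εT := Real.rpow_le_rpow hx0 (by linarith) (by linarith)
  -- the combinatorial inequality at `(X, M, K, Q)` (part 1)
  have hS : ∑ m ∈ Icc 1 M, |∑ d ∈ Icc 1 ⌊x / m⌋₊, (μ d : ℝ) * Λ (d * m + h)| =
      ∑ m ∈ Icc 1 M, |∑ d ∈ Icc 1 (X / m), (μ d : ℝ) * Λ (d * m + h)| :=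
    sum_congr rfl fun m _ => by rw [Nat.floor_div_natCast]
  rw [hS]
  -- the class sums `T(q)` at the single height `X + h`
  set T : ℕ → ℝ := fun q => ∑ n ∈ (Icc 1 (X + h)).filter (fun n : ℕ => n ≡ h [MOD q]),
    Λ n * (ArithmeticFunction.liouville (n - h) : ℝ)
  have hcomb : ∑ m ∈ Icc 1 M, |∑ d ∈ Icc 1 (X / m), (μ d : ℝ) * Λ (d * m + h)| ≤
      (K : ℝ) * ∑ q ∈ Icc 1 Q, |T q| +
        (X : ℝ) * Real.log ((X + h : ℕ) : ℝ) * (K : ℝ)⁻¹ * ∑ m ∈ Icc 1 M, (m : ℝ)⁻¹ :=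
    sum_abs_slice_le h X M K Q hK1 hKMQ
  have hTA_T : ∑ q ∈ Icc 1 Q, |T q| ≤ C * (x + h) / Real.log (x + h) ^ 6 := hTA
  have hXx : (X : ℝ) ≤ x := Nat.floor_le hx0
  have hxh2 : x + h ≤ 2 * x := by linarith
  have hLxh : L ≤ Real.log (x + h) := Real.log_le_log (by linarith) (by linarith)
  -- head
  have hhead : L * ((K : ℝ) * ∑ q ∈ Icc 1 Q, |T q|) ≤ 4 * C * (x / L) := by
    have h1 : ∑ q ∈ Icc 1 Q, |T q| ≤ C * (2 * x) / L ^ 6 :=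
      hTA_T.trans (div_le_div₀ (by positivity) (mul_le_mul_of_nonneg_left hxh2 hC) (by positivity)
        (pow_le_pow_left₀ hL0.le hLxh 6))
    calc L * ((K : ℝ) * ∑ q ∈ Icc 1 Q, |T q|)
        ≤ L * ((2 * L ^ 4) * (C * (2 * x) / L ^ 6)) := by gcongr
      _ = 4 * C * (x / L) := by field_simp; ring
  -- tail
  have htail : L * ((X : ℝ) * Real.log ((X + h : ℕ) : ℝ) * (K : ℝ)⁻¹ * ∑ m ∈ Icc 1 M, (m : ℝ)⁻¹) ≤
      2 * (1 + ε) * (x / L) := by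
    have hlg : Real.log ((X + h : ℕ) : ℝ) ≤ 2 * L := by
      have hXh1 : (0 : ℝ) < ((X + h : ℕ) : ℝ) := Nat.cast_pos.mpr (by omega)
      have hlog2 : Real.log 2 ≤ 1 := by
        have := Real.log_le_sub_one_of_pos (show (0 : ℝ) < 2 by norm_num)
        linarith
      calc Real.log ((X + h : ℕ) : ℝ) ≤ Real.log (2 * x) :=
            Real.log_le_log hXh1 (by push_cast; linarith)
        _ = Real.log 2 + L := by rw [Real.log_mul (by norm_num) (by linarith)]
        _ ≤ 2 * L := by linarith
    have hKinv : (K : ℝ)⁻¹ ≤ (L ^ 4)⁻¹ := inv_anti₀ (by positivity) hKgt.le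
    have hH : ∑ m ∈ Icc 1 M, (m : ℝ)⁻¹ ≤ (1 + ε) * L := by
      calc ∑ m ∈ Icc 1 M, (m : ℝ)⁻¹ ≤ 1 + Real.log (x ^ ε) :=
            sum_Icc_inv_le_one_add_log (Real.one_le_rpow hx1 hε.le)
        _ = 1 + ε * L := by rw [Real.log_rpow (by linarith)]
        _ ≤ (1 + ε) * L := by nlinarith
    have hlg0 : 0 ≤ Real.log ((X + h : ℕ) : ℝ) := Real.log_natCast_nonneg _
    calc L * ((X : ℝ) * Real.log ((X + h : ℕ) : ℝ) * (K : ℝ)⁻¹ * ∑ m ∈ Icc 1 M, (m : ℝ)⁻¹)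
        ≤ L * (x * (2 * L) * (L ^ 4)⁻¹ * ((1 + ε) * L)) := by gcongr
      _ = 2 * (1 + ε) * (x / L) := by field_simp
  calc L * ∑ m ∈ Icc 1 M, |∑ d ∈ Icc 1 (X / m), (μ d : ℝ) * Λ (d * m + h)|
      ≤ L * ((K : ℝ) * ∑ q ∈ Icc 1 Q, |T q| +
          (X : ℝ) * Real.log ((X + h : ℕ) : ℝ) * (K : ℝ)⁻¹ * ∑ m ∈ Icc 1 M, (m : ℝ)⁻¹) :=
        mul_le_mul_of_nonneg_left hcomb hL0.le
    _ = L * ((K : ℝ) * ∑ q ∈ Icc 1 Q, |T q|) +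
          L * ((X : ℝ) * Real.log ((X + h : ℕ) : ℝ) * (K : ℝ)⁻¹ * ∑ m ∈ Icc 1 M, (m : ℝ)⁻¹) :=
        mul_add _ _ _
    _ ≤ 4 * C * (x / L) + 2 * (1 + ε) * (x / L) := add_le_add hhead htail
    _ = (4 * C + 2 * (1 + ε)) * (x / L) := by ring

/-- `TAvgAt h` gives the unweighted `ℓ¹`-form of `MAvg` at the shift `h` with one logarithm to
spare:
`log x · ∑_{m ≤ x^ε} |∑_{d ≤ x/m} μ(d) Λ(dm + h)| = o(x)` with `ε = ε_T / 4`. [this line] -/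
theorem isLittleO_log_mul_sum_abs_slice {h : ℕ} (hh : 1 ≤ h) (hT : TAvgAt h) :
    ∃ ε : ℝ, 0 < ε ∧
      (fun x : ℝ => Real.log x * ∑ m ∈ Icc 1 ⌊x ^ ε⌋₊,
          |∑ d ∈ Icc 1 ⌊x / m⌋₊, (μ d : ℝ) * Λ (d * m + h)|) =o[atTop] fun x : ℝ => x := by
  obtain ⟨εT, hεT, H⟩ := hT
  obtain ⟨C, x₀, HC⟩ := H (6 : ℕ) (by norm_num)
  have hε : 0 < εT / 4 := by positivity
  refine ⟨εT / 4, hε, ?_⟩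
  have h8 := (isLittleO_log_rpow_rpow_atTop ((8 : ℕ) : ℝ) hε).bound
    (show (0 : ℝ) < 1 / 4 by norm_num)
  have key : ∀ᶠ x : ℝ in atTop, ‖Real.log x * ∑ m ∈ Icc 1 ⌊x ^ (εT / 4)⌋₊,
      |∑ d ∈ Icc 1 ⌊x / m⌋₊, (μ d : ℝ) * Λ (d * m + h)|‖ ≤
        (4 * max C 0 + 2 * (1 + εT / 4)) * ‖x / Real.log x‖ := by
    filter_upwards [h8, tendsto_log_atTop.eventually_ge_atTop (1 : ℝ), eventually_ge_atTop (2 : ℝ),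
      eventually_ge_atTop (h : ℝ), eventually_ge_atTop x₀] with x hlog8 hL hx2 hxh hx₀
    have hx0 : 0 ≤ x := by linarith
    have hL0 : 0 < Real.log x := by linarith
    have hh0 : (0 : ℝ) ≤ h := Nat.cast_nonneg h
    -- `TAvg` at `x + h`, height `y = x + h`
    have hTA := HC (x + h) (by linarith) (x + h) (by linarith) le_rfl
    rw [Real.rpow_natCast, Nat.floor_add_natCast hx0] at hTA
    have hTA' : ∑ q ∈ Icc 1 ⌊(x + h) ^ εT⌋₊,
        |∑ n ∈ (Icc 1 (⌊x⌋₊ + h)).filter (fun n : ℕ => n ≡ h [MOD q]),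
          Λ n * (ArithmeticFunction.liouville (n - h) : ℝ)| ≤
        max C 0 * (x + h) / Real.log (x + h) ^ 6 :=
      hTA.trans (div_le_div_of_nonneg_right
        (mul_le_mul_of_nonneg_right (le_max_left C 0) (by linarith)) (by positivity))
    have hlog8' : 4 * Real.log x ^ 8 ≤ x ^ (εT / 4) := by
      rw [Real.rpow_natCast, Real.norm_of_nonneg (show 0 ≤ Real.log x ^ 8 by positivity),
        Real.norm_of_nonneg (show 0 ≤ x ^ (εT / 4) by positivity)] at hlog8
      linarith
    rw [Real.norm_of_nonneg (mul_nonneg hL0.le (sum_nonneg fun _ _ => abs_nonneg _)),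
      Real.norm_of_nonneg (div_nonneg hx0 hL0.le)]
    exact log_mul_sum_abs_slice_le hh hε (by linarith) (le_max_right C 0) hTA' hL hx2 hxh hlog8'
  exact (IsBigO.of_bound _ key).trans_isLittleO isLittleO_div_log_self

/-- `log m ≤ ε log x` on the range `1 ≤ m ≤ ⌊x^ε⌋`: the `MAvg` sum is at most `ε log x` times the
unweighted `ℓ¹`-sum. [folklore] -/
theorem sum_log_mul_abs_le {ε x : ℝ} (hx : 1 ≤ x) (F : ℕ → ℝ) :
    ∑ m ∈ Icc 1 ⌊x ^ ε⌋₊, Real.log (m : ℝ) * |F m| ≤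
      ε * (Real.log x * ∑ m ∈ Icc 1 ⌊x ^ ε⌋₊, |F m|) := by
  rw [Finset.mul_sum, Finset.mul_sum]
  refine sum_le_sum fun m hm => ?_
  obtain ⟨hm1, hm2⟩ := mem_Icc.mp hm
  have hx0 : 0 < x := by linarith
  have hmle : (m : ℝ) ≤ x ^ ε := (Nat.le_floor_iff (by positivity)).mp hm2
  have hlog : Real.log (m : ℝ) ≤ ε * Real.log x := by
    rw [← Real.log_rpow hx0]
    exact Real.log_le_log (by exact_mod_cast hm1) hmle
  rw [← mul_assoc]
  exact mul_le_mul_of_nonneg_right hlog (abs_nonneg _)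

/-- **Stub S2 of line `Sketch`** (crux `EngineToPairs`, stmt-Parity-14659): the hinge implies the
route's terminal parity node, `TAvg → MAvg` (the `k²`-trick at the single height `x + h`,
`K ≍ (log x)^4`, `A = 6`, then `log m ≤ ε log x`). [this line] -/
theorem stub_MAvg_of_TAvg : TAvg → MAvg := by
  intro hT h hh
  obtain ⟨ε, hε, hO⟩ := isLittleO_log_mul_sum_abs_slice hh (hT h hh)
  -- adapted from `Theorems.MAvg_of_isLittleO_log_mul_sum_abs_slices` (MAvgSlices file)
  refine ⟨ε, hε, IsBigO.trans_isLittleO (IsBigO.of_bound ε ?_) hO⟩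
  filter_upwards [eventually_ge_atTop (1 : ℝ)] with x hx
  have hnn : 0 ≤ ∑ m ∈ Icc 1 ⌊x ^ ε⌋₊, Real.log (m : ℝ) *
      |∑ d ∈ Icc 1 ⌊x / m⌋₊, (μ d : ℝ) * Λ (d * m + h)| :=
    sum_nonneg fun m _ => mul_nonneg (Real.log_natCast_nonneg m) (abs_nonneg _)
  rw [Real.norm_eq_abs, Real.norm_eq_abs, abs_of_nonneg hnn]
  exact (sum_log_mul_abs_le hx _).trans (mul_le_mul_of_nonneg_left (le_abs_self _) hε.le)

end Summit.Parity.GeneralizedHardyLittlewood.Theorems.EngineToPairs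

end
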